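import Literature.NumberTheory.CubicFields.ThreeTorsionMeanDecomposition
import Literature.NumberTheory.QuadraticFields.ThreeTorsionMeanTwoAdicProofs
import HarnessLib

/-!
# Taniguchi–Thorne at the prime `2` (`tt_threeTorsion_twoAdic`) on genuine objects: reduction to
# Hasse's dictionary and the counts of cubic fields with a `2`-adic specification

Topic `Literature/NumberTheory/CubicFields` × `QuadraticFields`. Theorem-only file (no definition,
no named fact; D-0026): it instantiates the quadratic-side reduction
`QuadraticFields/ThreeTorsionMeanTwoAdicProofs.lean` (`tt_threeTorsion_twoAdic_of_cubicCount`,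
`tt_twoAdic_sum_neg_iff_cubicCount`, `tt_twoAdic_sum_pos_iff_cubicCount`, stated there for an
abstract count `c : ℤ → ℕ` under the dictionary `#Cl₃(D) = 2·c(D) + 1`) with the tree's genuine
objects, exactly as `ThreeTorsionBridge.lean` does for `btt_threeTorsion_sum` and
`ThreeTorsionMeanLocalAtThreeBridge.lean` for `bv_threeTorsion_mean_localAtThree`:

* `cubicFieldCountOfDisc D` — the number of cubic fields of discriminant `D` up to isomorphism
  (`ThreeTorsionBridge.lean`);
* the named fact `threeTorsion_eq_two_mul_cubicFieldCountOfDisc_add_one` — Hasse's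
  class-field-theoretic dictionary `#Cl(ℚ(√D))[3] = 2 · cubicFieldCountOfDisc D + 1` on fundamental
  `D` (`ThreeTorsionMeanDecomposition.lean`; Taniguchi–Thorne §6.1: "we use the following classical
  result of Hasse … It therefore suffices to count cubic fields which are nowhere totally ramified",
  §6.3: "subgroups of `Cl(D)` of index 3 are in bijection with cubic fields of discriminant `D`").

Printed proof being followed (Taniguchi–Thorne 2013 = arXiv:1102.2914, §6): Thm 4 with a
specification at `2` and Thm 25 for `χ (mod 2ᵏ)` are statements about
`M₃^±(X, 𝒮₂; r, χ) = Σ'_{K ∈ 𝒮₂, 0<±Disc K ≤ X} χ(Disc(K)/r)`, the (twisted) number of cubic fields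
`K` with `K ⊗ ℚ₂` prescribed; grouped by `D = Disc(K)` (fundamental, of `2`-adic type `(r, s)`,
i.e. `D ≡ rs (mod 8r)`) this is `Σ_D χ(D/r) · cubicFieldCountOfDisc D`. Contents (all PROVED):

* `tt_threeTorsion_twoAdic_of_hasse_of_cubicFieldCount` — the dictionary (named fact, hypothesis),
  the two-term counts `Σ_{0<∓D<X, D ≡ rs (8r)} cubicFieldCountOfDisc D = X/(2rπ²)` resp.
  `X/(6rπ²)` ` + K X^{5/6} + O_ε(X^{18/23+ε})` for the eight types (Thm 4/§6.3:
  `C^± C'(𝒮)/(2π²)`, `C⁻ = 3`, `C⁺ = 1`, `C'(𝒮) = 1/(3r)`) and the bounds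
  `Σ_{D of type (r,s)} ψ(D/r) cubicFieldCountOfDisc D = O_ε(X^{18/23+ε})` for primitive `ψ` of
  conductor `2ʲ ≥ 16` with `ψ⁶ ≠ 1` (Thm 25) imply `tt_threeTorsion_twoAdic`;
* `cubicFieldCount_twoAdicType_neg_of_tt`, `cubicFieldCount_twoAdicType_pos_of_tt` — conversely the
  fact and the dictionary give back the two-term counts of cubic fields of each `2`-adic type (the
  constants `1/(2rπ²)`, `1/(6rπ²)` are forced).

So `tt_threeTorsion_twoAdic_holds` is reduced to Hasse's dictionary (an existing named fact) and the
analytic core of Taniguchi–Thorne at the prime `2` on genuine objects — the Shintani-zeta-function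
count of cubic fields with ONE `2`-adic specification (error `X^{18/23+ε}`) and its twists by
primitive characters of `2`-power conductor (orbital `L`-functions, entire for `ψ⁶ ≠ 1`), neither of
which is in Mathlib or in this library.

## References

* T. Taniguchi, F. Thorne, *Secondary terms in counting functions for cubic fields*, Duke Math. J.
  162 (2013) 2451–2508 = arXiv:1102.2914: Thm 4, §6.1, §6.3, §6.4, Thm 25 (§6.6)
  [TaniguchiThorne2013].
* M. Bhargava, A. Shankar, J. Tsimerman, *On the Davenport–Heilbronn theorems and second order
  terms*, Invent. Math. 193 (2013) = arXiv:1005.0672, §8.5 (the dictionary)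
  [BhargavaShankarTsimerman2012].
-/

noncomputable section

open Finset

namespace Literature.NumberTheory.CubicFields

open Literature.NumberTheory.QuadraticFields

/-- **`tt_threeTorsion_twoAdic` on genuine objects** (Taniguchi–Thorne, Thm 4 with §6.3 and Thm 25
at the prime `2`, reduced). Assume Hasse's dictionary
`#Cl₃(D) = 2 · cubicFieldCountOfDisc D + 1` on fundamental `D` (the named fact
`threeTorsion_eq_two_mul_cubicFieldCountOfDisc_add_one`) and, for every admissible `2`-adic type
`(r, s)` (`D ≡ rs (mod 8r)`, `e(rs, 2) = 1`): the two-term counts of cubic fields of that type,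
`Σ_{-X<D<0} cubicFieldCountOfDisc D = X/(2rπ²) + K⁻ X^{5/6} + O_ε(X^{18/23+ε})`,
`Σ_{0<D<X} cubicFieldCountOfDisc D = X/(6rπ²) + K⁺ X^{5/6} + O_ε(X^{18/23+ε})` (Thm 4 with §6.3 in
`M₃`-form), and the twisted bounds `Σ ψ(D/r) cubicFieldCountOfDisc D = O_ε(X^{18/23+ε})` for every
primitive `ψ (mod 2ʲ)`, `j ≥ 4`, `ψ⁶ ≠ 1`, both signs (Thm 25, `M₃^±(X, 𝒮₂; r, ψ)`). Then
`tt_threeTorsion_twoAdic`. [cite: TaniguchiThorne2013, Theorem 4 (§6.3) and Theorem 25 (§6.1, §6.4, §6.6)] -/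
theorem tt_threeTorsion_twoAdic_of_hasse_of_cubicFieldCount
    (h₁ : threeTorsion_eq_two_mul_cubicFieldCountOfDisc_add_one)
    (hcount : ∀ r ∈ ({1, 4, 8} : Finset ℕ), ∀ s ∈ ({1, 3, 5, 7} : Finset ℤ),
      ttLocalFactorTwo (r * s) = 1 →
      (∃ K : ℝ, ∀ ε : ℝ, 0 < ε → ∃ C : ℝ, ∀ X : ℕ, 1 ≤ X →
        |(∑ D ∈ (negFundDiscrs X).filter (fun D => D ≡ r * s [ZMOD ((8 * r : ℕ) : ℤ)]),
            (cubicFieldCountOfDisc D : ℝ)) - 1 / (2 * r * Real.pi ^ 2) * X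
            - K * (X : ℝ) ^ ((5 : ℝ) / 6)| ≤ C * (X : ℝ) ^ ((18 : ℝ) / 23 + ε)) ∧
      (∃ K : ℝ, ∀ ε : ℝ, 0 < ε → ∃ C : ℝ, ∀ X : ℕ, 1 ≤ X →
        |(∑ D ∈ (posFundDiscrs X).filter (fun D => D ≡ r * s [ZMOD ((8 * r : ℕ) : ℤ)]),
            (cubicFieldCountOfDisc D : ℝ)) - 1 / (6 * r * Real.pi ^ 2) * X
            - K * (X : ℝ) ^ ((5 : ℝ) / 6)| ≤ C * (X : ℝ) ^ ((18 : ℝ) / 23 + ε)))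
    (htwist : ∀ r ∈ ({1, 4, 8} : Finset ℕ), ∀ s ∈ ({1, 3, 5, 7} : Finset ℤ),
      ttLocalFactorTwo (r * s) = 1 → ∀ j : ℕ, 4 ≤ j → ∀ ψ : DirichletCharacter ℂ (2 ^ j),
      ψ.IsPrimitive → ψ ^ 6 ≠ 1 →
      (∀ ε : ℝ, 0 < ε → ∃ C : ℝ, ∀ X : ℕ, 1 ≤ X →
        ‖∑ D ∈ (negFundDiscrs X).filter (fun D => D ≡ r * s [ZMOD ((8 * r : ℕ) : ℤ)]),
            ψ (((D / (r : ℤ) : ℤ)) : ZMod (2 ^ j)) * (cubicFieldCountOfDisc D : ℂ)‖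
          ≤ C * (X : ℝ) ^ ((18 : ℝ) / 23 + ε)) ∧
      (∀ ε : ℝ, 0 < ε → ∃ C : ℝ, ∀ X : ℕ, 1 ≤ X →
        ‖∑ D ∈ (posFundDiscrs X).filter (fun D => D ≡ r * s [ZMOD ((8 * r : ℕ) : ℤ)]),
            ψ (((D / (r : ℤ) : ℤ)) : ZMod (2 ^ j)) * (cubicFieldCountOfDisc D : ℂ)‖
          ≤ C * (X : ℝ) ^ ((18 : ℝ) / 23 + ε))) :
    tt_threeTorsion_twoAdic :=
  tt_threeTorsion_twoAdic_of_cubicCount h₁ hcount htwist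

/-- **Conversely (imaginary fields)**: `tt_threeTorsion_twoAdic` and Hasse's dictionary give the
two-term count of cubic fields of each `2`-adic type with negative discriminant,
`Σ_{-X<D<0, D ≡ rs (8r)} cubicFieldCountOfDisc D = X/(2rπ²) + K X^{5/6} + O_ε(X^{18/23+ε})`.
[cite: TaniguchiThorne2013, Theorem 4 (§6.3) with §6.1] -/
theorem cubicFieldCount_twoAdicType_neg_of_tt (h : tt_threeTorsion_twoAdic)
    (h₁ : threeTorsion_eq_two_mul_cubicFieldCountOfDisc_add_one) {r : ℕ} {s : ℤ}
    (hr : r ∈ ({1, 4, 8} : Finset ℕ)) (hs : s ∈ ({1, 3, 5, 7} : Finset ℤ))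
    (he : ttLocalFactorTwo (r * s) = 1) :
    ∃ K : ℝ, ∀ ε : ℝ, 0 < ε → ∃ C : ℝ, ∀ X : ℕ, 1 ≤ X →
      |(∑ D ∈ (negFundDiscrs X).filter (fun D => D ≡ r * s [ZMOD ((8 * r : ℕ) : ℤ)]),
          (cubicFieldCountOfDisc D : ℝ)) - 1 / (2 * r * Real.pi ^ 2) * X
          - K * (X : ℝ) ^ ((5 : ℝ) / 6)| ≤ C * (X : ℝ) ^ ((18 : ℝ) / 23 + ε) :=
  (tt_twoAdic_sum_neg_iff_cubicCount hr hs he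
    (fun _ D hD => h₁ D (mem_negFundDiscrs.1 hD).2)).1 (h.sum_neg hr hs he)

/-- **Conversely (real fields)**: `tt_threeTorsion_twoAdic` and Hasse's dictionary give
`Σ_{0<D<X, D ≡ rs (8r)} cubicFieldCountOfDisc D = X/(6rπ²) + K X^{5/6} + O_ε(X^{18/23+ε})`.
[cite: TaniguchiThorne2013, Theorem 4 (§6.3) with §6.1] -/
theorem cubicFieldCount_twoAdicType_pos_of_tt (h : tt_threeTorsion_twoAdic)
    (h₁ : threeTorsion_eq_two_mul_cubicFieldCountOfDisc_add_one) {r : ℕ} {s : ℤ}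
    (hr : r ∈ ({1, 4, 8} : Finset ℕ)) (hs : s ∈ ({1, 3, 5, 7} : Finset ℤ))
    (he : ttLocalFactorTwo (r * s) = 1) :
    ∃ K : ℝ, ∀ ε : ℝ, 0 < ε → ∃ C : ℝ, ∀ X : ℕ, 1 ≤ X →
      |(∑ D ∈ (posFundDiscrs X).filter (fun D => D ≡ r * s [ZMOD ((8 * r : ℕ) : ℤ)]),
          (cubicFieldCountOfDisc D : ℝ)) - 1 / (6 * r * Real.pi ^ 2) * X
          - K * (X : ℝ) ^ ((5 : ℝ) / 6)| ≤ C * (X : ℝ) ^ ((18 : ℝ) / 23 + ε) :=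
  (tt_twoAdic_sum_pos_iff_cubicCount hr hs he
    (fun _ D hD => h₁ D (mem_posFundDiscrs.1 hD).2)).1 (h.sum_pos hr hs he)

end Literature.NumberTheory.CubicFields

end
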